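import Summits.HodgeConjecture.HodgeConjecture.Theorems.Ring2WeilCoverageRealGeneratorTypes
import Summits.HodgeConjecture.HodgeConjecture.Theorems.Ring2WeilCoverageCyclotomicSignaturesG6
import Summits.HodgeConjecture.HodgeConjecture.Theorems.Ring2WeilCoverageCyclotomicUnconditional
import Summits.HodgeConjecture.HodgeConjecture.Theorems.Ring2WeilCoverageResidueDictionaryRowsA
import HarnessLib

/-!
# Weil-type family coverage — THE QUADRATIC-SURD TYPE AT LEVEL `28`: every `ℚ(√−7)`-balanced CM type of `ℚ(ζ₂₈)` (the NO row
# `(28, √−7)`) carries a polarisation of type `(2 + √7)` — the prime of `ℚ(ζ₂₈)⁺` over the unramified inert prime `3` — of degree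
# `27`, whose polarised CM points lie on the NON-SPLIT row `(3, ℚ(√−7), 3)` (S-pencil); the `ℚ(i)`-balanced types do not

research route conditional on HC_CM; not a corollary; Q11.4-sentence-2 already refuted in dim ≥ 3.

Ring 2, WEIL-TYPE FAMILY-COVERAGE CENSUS (`HOME/WEIL-FAMILY-COVERAGE.md` `## b01`, blocks b01.34 (the NO row `(28, √−7)`), b01.41
(ramified types); owner ring2-b01), part 54b of the `Ring2WeilCoverage*` series (part 53's engine; 54a = level 21, 54c = level
36).  `ℚ(ζ₂₈)⁺ ∋ θ₇ = ζ⁷(1 + 2(ζ⁴ + ζ⁸ + ζ¹⁶))`, `θ₇² = 7`, real (part 30′).  `3` has order `6` mod `28` with `3³ ≡ −1`: the prime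
of `ℚ(ζ₂₈)⁺` above `3` is INERT in `ℚ(ζ₂₈)` and principal with the surd generator `ϖ₃ = 2 + θ₇` of norm `4 − 7 = −3 < 0` — so
`|A_ϖ|/2 = 3` and the principal verdict FLIPS (parts 48/53):

* `re_sqrtSeven` (**sign dictionary of `√7 ∈ ℚ(ζ₂₈)⁺`**: `Re σ_t(θ₇) < 0 ↔ t ∈ {1, 3, 9, 19, 25, 27}` — where the signs of
  `Im σ_t(i)` and of the Gauss sum `σ_t(1 + 2(η + η² + η⁴))` (parts 26/27a) agree; `(Re σ_t θ₇)² = 7`, `Im = 0`);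
* `signSet_twentyEight_three` (`Re σ_t(ϖ₃) < 0 ↔ t ∈ {1,3,9,19,25,27}`; `ϖ₃` real, non-zero), `twistSetA_twentyEight`
  (`X = N_odd ∆ A = {3, 5, 9, 11, 15, 27}`, `decide`), `span_mul_span_twentyEight_three` (`(ϖ₃)(ϖ₃′) = (3)` in `𝓞 K`: `N(𝔣₀) = 27`);
* **`exists_type_twentyEight_three_sqrt_neg_seven`** (EVERY `ℚ(√−7)`-balanced `Φ`, every `𝔣₀` with `𝔬𝔣₀ = (ϖ₃)`: a `Φ`-positive
  divisor of type `(K; Φ; 𝔣₀)` on `ℂ^Φ/Φ(ℤ[ζ₂₈])`; `|S_Φ ∩ X| ≡ 3 + 3`), headline **`exists_surdType_twentyEight_three_sqrt_neg_seven`**,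
  `not_exists_type_twentyEight_three_sqrt_neg_one` (the YES row: `|S_Φ ∩ X| ≡ 2 + 3`).

COMPONENTS (S-pencil, exact hermitian determinants, `g61/py/component_surd.py`): on the `(28, √−7)`-balanced `ℤ[ζ₂₈]`-tori the type
`(2 + √7)` has `a = 27 ≡ 3`, `T(a) = {3, 7}` — **the NON-split row `(3, ℚ(√−7), 3)`**, for all twenty such CM types, each with an
explicit `𝒪_L`-linear polarisation of degree `27`; on the `ℚ(i)`-balanced tori `a = −27 < 0` (no polarisation, as proved).

HONEST FRAMING: torus-level statements about Shimura's divisors of type `(K; Φ; 𝔣₀)` on `ℂ^Φ/Φ(ℤ[ζ₂₈])` [Sh98 §14.3 Prop. 4–5],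
elementary arithmetic of `ℤ[ζ₂₈]` and residue combinatorics (`decide`); the component statement is S-pencil (docstring
only); nothing here is a statement about Hodge classes, `W_K`, general members or HC; `HC_CM` is used nowhere.  No `def`, no
named fact, no `sorry`.

References: [cite: Shimura1998, §14.3 Prop. 4–5, pp. 103–104]; [cite: vanGeemen1994HodgeAV, Lemma 5.2, Thm. 5.10];
[cite: Washington1997, Lemma 4.8]; census b01.17 / b01.41 (seat-derived).
-/

noncomputable section

open Polynomial NumberField Complex Finset
open scoped Real nonZeroDivisors

namespace Summit.HodgeConjecture.Ring2WeilCoverage.SurdTypesLevel28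

open Literature.AlgebraicGeometry.Motives (CMType)
open Literature.AlgebraicGeometry.HodgeTheory (IsCMTypeSet)
open Literature.AlgebraicGeometry.ComplexMultiplication.CyclotomicCMType (isCMTypeSet_residueFilter exists_apply_eq_toCircle)
open Literature.NumberTheory.ComplexMultiplication
open Summit.HodgeConjecture.Ring2WeilCoverage.RealGeneratorTypes
open Summit.HodgeConjecture.Ring2WeilCoverage.RamifiedTypes (card_inter_mod_two_eq)
open Summit.HodgeConjecture.Ring2WeilCoverage.CyclotomicPrincipalObstruction (coprime_of_apply_eq_toCircle)
open Summit.HodgeConjecture.Ring2WeilCoverage.CMTypeSetOddPositions (two_mul_card_eq_card_units)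
open Summit.HodgeConjecture.Ring2WeilCoverage.CyclotomicSignaturesG6
  (exists_units_sign_eq_twentyEight)
open Summit.HodgeConjecture.Ring2WeilCoverage.CyclotomicUnconditional
  (sq_sqrtSeven complexConj_sqrtSeven norm_realUnits_pos_twentyEight)
open Summit.HodgeConjecture.Ring2WeilCoverage.ResidueDictionaryPieces
  (im_embedding_sqrtNegSeven_neg_iff im_embedding_sqrtNegOne_neg_iff)
open Summit.HodgeConjecture.Ring2WeilCoverage.ResidueDictionaryRowsA (nK_twentyEight_sqrt_neg_one nK_twentyEight_sqrt_neg_seven)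

variable {K : Type} [Field K] [NumberField K] {ζ : K}

/-- `𝐞(t) = exp(2πi t/n) ∈ ℂ` (`ZMod.toCircle`). -/
local notation3 (prettyPrint := false) "𝐞 " t:max => ((ZMod.toCircle t : Circle) : ℂ)

section Level28

/-- the residue set `S_Φ` read at level `28`. -/
local notation3 (prettyPrint := false) "SΦ[" Φ "," z "]" =>
  (Finset.univ.filter fun t : ZMod 28 => ∃ σ ∈ (Φ : CMType K).1, σ (z : K) = 𝐞 t)

/-- part 53's twisted set `X_A` at level `28`. -/
local notation3 (prettyPrint := false) "XA28 " A:max =>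
  (Finset.univ.filter fun t : ZMod 28 => t.val.Coprime 28 ∧
    ¬ (t ∈ (A : Finset (ZMod 28)) ↔ Even (Finset.card (Finset.filter (fun s : ZMod 28 => s.val.Coprime 28 ∧ s.val < t.val) Finset.univ))))

/-- `θ₇ = ζ⁷(1 + 2(ζ⁴ + ζ⁸ + ζ¹⁶))` (`θ₇² = 7`, real; part 30′). -/
local notation3 (prettyPrint := false) "θ7[" z "]" => ((z : K) ^ 7 * (1 + 2 * ((z : K) ^ 4 + (z : K) ^ 8 + (z : K) ^ 16)))

/-- **The sign dictionary of `√7 ∈ ℚ(ζ₂₈)⁺`**: for `φ ζ = 𝐞(t)`, `Re φ(θ₇) < 0 ↔ t ∈ {1, 3, 9, 19, 25, 27}` (`θ₇ = i^t · i√7·ε₇(t)`: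
negative where the signs of `Im σ_t(ζ⁷)` and `Im σ_t(1 + 2(η + η² + η⁴))` agree), `(Re φ θ₇)² = 7`, `Im φ θ₇ = 0`.
research route conditional on HC_CM; not a corollary; Q11.4-sentence-2 already refuted in dim ≥ 3. [cite: Washington1997, Lemma 4.8] -/
theorem re_sqrtSeven (hζ : IsPrimitiveRoot ζ 28) {φ : K →+* ℂ} {t : ZMod 28} (hφt : φ ζ = 𝐞 t) :
    ((φ (θ7[ζ])).re < 0 ↔ t ∈ ({1, 3, 9, 19, 25, 27} : Finset (ZMod 28))) ∧ (φ (θ7[ζ])).re ^ 2 = 7 ∧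
      (φ (θ7[ζ])).im = 0 := by
  have ht := coprime_of_apply_eq_toCircle hζ hφt
  have k1 := im_embedding_sqrtNegOne_neg_iff (K := K) (n := 28) (by norm_num) hφt ht
  have k7 := im_embedding_sqrtNegSeven_neg_iff (K := K) (n := 28) (by norm_num) hφt ht
  simp only [Nat.reduceDiv, Nat.reduceMul] at k1 k7
  have i1 := nK_twentyEight_sqrt_neg_one hφt ht
  have i7 := nK_twentyEight_sqrt_neg_seven hφt ht
  have hη : IsPrimitiveRoot (ζ ^ 4) 7 := hζ.pow (by norm_num) (by norm_num)
  have h14 : ζ ^ 14 = -1 := by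
    have hsq : (ζ ^ 14) ^ 2 = 1 := by rw [← pow_mul]; exact hζ.pow_eq_one
    have hne : ζ ^ 14 ≠ 1 := hζ.pow_ne_one_of_pos_of_lt (by norm_num) (by norm_num)
    have : (ζ ^ 14 - 1) * (ζ ^ 14 + 1) = 0 := by linear_combination hsq
    rcases mul_eq_zero.mp this with h | h
    · exact absurd (sub_eq_zero.mp h) hne
    · linear_combination h
  have s1 : (φ (ζ ^ 7)) ^ 2 = -1 := by
    rw [← map_pow, ← pow_mul, show 7 * 2 = 14 by rfl, h14, map_neg, map_one]
  have s7 : (φ (1 + 2 * (ζ ^ 4 + ζ ^ 8 + ζ ^ 16))) ^ 2 = -7 := by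
    have h7 := hη.geom_sum_eq_zero (by norm_num : 1 < 7)
    simp only [Finset.sum_range_succ, Finset.sum_range_zero, zero_add, pow_zero, pow_one] at h7
    have hη7 : (ζ ^ 4) ^ 7 = 1 := hη.pow_eq_one
    rw [← map_pow, show (1 + 2 * (ζ ^ 4 + ζ ^ 8 + ζ ^ 16)) ^ 2 = (-7 : K) by
      linear_combination (4 * ζ ^ 4) * hη7 + 8 * h7, map_neg, map_ofNat]
  have y1 : (φ (ζ ^ 7)).im ^ 2 = 1 := by
    have := congrArg Complex.re s1
    rw [pow_two, Complex.mul_re, k1.2] at this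
    simp only [zero_mul, zero_sub, Complex.neg_re, Complex.one_re, neg_inj] at this
    rw [pow_two]; exact this
  have y7 : (φ (1 + 2 * (ζ ^ 4 + ζ ^ 8 + ζ ^ 16))).im ^ 2 = 7 := by
    have := congrArg Complex.re s7
    rw [pow_two, Complex.mul_re, k7.2] at this
    simp only [zero_mul, zero_sub, Complex.neg_re, Complex.re_ofNat, neg_inj] at this
    rw [pow_two]; exact this
  have hre : (φ (ζ ^ 7) * φ (1 + 2 * (ζ ^ 4 + ζ ^ 8 + ζ ^ 16))).re =
      -((φ (ζ ^ 7)).im * (φ (1 + 2 * (ζ ^ 4 + ζ ^ 8 + ζ ^ 16))).im) := by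
    rw [Complex.mul_re, k1.2, k7.2]; ring
  have hdec : ∀ s : ZMod 28, s.val.Coprime 28 →
      ((s ∈ ({3, 11, 15, 19, 23, 27} : Finset (ZMod 28)) ↔ s ∈ ({3, 5, 13, 17, 19, 27} : Finset (ZMod 28))) ↔
        s ∈ ({1, 3, 9, 19, 25, 27} : Finset (ZMod 28))) := by
    decide
  refine ⟨?_, ?_, ?_⟩
  · rw [map_mul, hre, neg_lt_zero, ← hdec t ht, ← i1, ← i7]
    set a := (φ (ζ ^ 7)).im with ha
    set b := (φ (1 + 2 * (ζ ^ 4 + ζ ^ 8 + ζ ^ 16))).im with hb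
    have ha0 : a ≠ 0 := k1.1.2
    have hb0 : b ≠ 0 := k7.1.2
    rcases lt_or_gt_of_ne ha0 with h1 | h1 <;> rcases lt_or_gt_of_ne hb0 with h2 | h2
    · exact ⟨fun _ => ⟨fun _ => h2, fun _ => h1⟩, fun _ => mul_pos_of_neg_of_neg h1 h2⟩
    · exact ⟨fun h => absurd h (not_lt.mpr (mul_nonpos_of_nonpos_of_nonneg h1.le h2.le)),
        fun h => absurd (h.mp h1) (not_lt.mpr h2.le)⟩
    · exact ⟨fun h => absurd h (not_lt.mpr (mul_nonpos_of_nonneg_of_nonpos h1.le h2.le)),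
        fun h => absurd (h.mpr h2) (not_lt.mpr h1.le)⟩
    · exact ⟨fun _ => ⟨fun h => absurd h (not_lt.mpr h1.le), fun h => absurd h (not_lt.mpr h2.le)⟩, fun _ => mul_pos h1 h2⟩
  · rw [map_mul, hre, neg_sq, mul_pow, y1, y7]; norm_num
  · rw [map_mul, Complex.mul_im, k1.2, k7.2]; ring

/-- **`ϖ₃ = 2 + θ₇` (a generator of a prime of `ℚ(ζ₂₈)⁺` over `3`, inert in `ℚ(ζ₂₈)`): `Re φ(ϖ₃) < 0 ↔ t ∈ {1, 3, 9, 19, 25, 27}`**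
(`√7 > 2`); `ϖ₃` real, non-zero.
research route conditional on HC_CM; not a corollary; Q11.4-sentence-2 already refuted in dim ≥ 3. [folklore] -/
theorem signSet_twentyEight_three [IsCMField K] (hζ : IsPrimitiveRoot ζ 28) :
    (∀ (φ : K →+* ℂ) (t : ZMod 28), φ ζ = 𝐞 t →
      ((φ (2 + θ7[ζ])).re < 0 ↔ t ∈ ({1, 3, 9, 19, 25, 27} : Finset (ZMod 28)))) ∧
    IsCMField.complexConj K (2 + θ7[ζ]) = 2 + θ7[ζ] ∧ (2 + θ7[ζ]) ≠ 0 := by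
  have key : ∀ r : ℝ, r ^ 2 = 7 → ((2 + r < 0 ↔ r < 0) ∧ 2 + r ≠ 0) := fun r hr =>
    ⟨⟨fun h => by nlinarith, fun h => by nlinarith⟩, fun h => by nlinarith⟩
  refine ⟨fun φ t hφt => ?_, by rw [map_add, map_ofNat, complexConj_sqrtSeven hζ], fun h0 => ?_⟩
  · obtain ⟨hiff, hsq, -⟩ := re_sqrtSeven hζ hφt
    rw [map_add, Complex.add_re, map_ofNat, show ((2 : ℂ)).re = 2 by norm_num, ← hiff]
    exact (key _ hsq).1
  · obtain ⟨φ⟩ := (inferInstance : Nonempty (K →+* ℂ))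
    obtain ⟨t, -, hφt⟩ := exists_apply_eq_toCircle hζ φ
    obtain ⟨-, hsq, -⟩ := re_sqrtSeven hζ hφt
    apply (key _ hsq).2
    have := congrArg Complex.re (congrArg φ h0)
    rw [map_add, map_zero, Complex.add_re, map_ofNat] at this
    simpa using this

/-- **`X_A = N_odd ∆ A = {3, 5, 9, 11, 15, 27}` at level `28`** for `A = {1, 3, 9, 19, 25, 27}` (`decide`; `|N_odd ∖ X| = 3`).
research route conditional on HC_CM; not a corollary; Q11.4-sentence-2 already refuted in dim ≥ 3. [folklore] -/
theorem twistSetA_twentyEight :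
    XA28 ({1, 3, 9, 19, 25, 27} : Finset (ZMod 28)) = ({3, 5, 9, 11, 15, 27} : Finset (ZMod 28)) := by
  decide

omit [NumberField K] in
/-- The integer `2 + Θ₇` of `𝓞 K` coerces to `ϖ₃`. [folklore] -/
theorem coe_surd_twentyEight (hζ : IsPrimitiveRoot ζ 28) :
    (((2 + hζ.toInteger ^ 7 * (1 + 2 * (hζ.toInteger ^ 4 + hζ.toInteger ^ 8 + hζ.toInteger ^ 16)) : 𝓞 K)) : K) =
      2 + θ7[ζ] := by
  push_cast
  rfl

omit [NumberField K] in
/-- **`(ϖ₃)·(ϖ₃′) = (3)`** in `𝓞 K`, `ϖ₃′ = 2 − θ₇` (`4 − 7 = −3`; `N(𝔣₀) = 27`: degree `27`, elementary divisors `(1,1,1,3,3,3)`).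
research route conditional on HC_CM; not a corollary; Q11.4-sentence-2 already refuted in dim ≥ 3. [folklore] -/
theorem span_mul_span_twentyEight_three (hζ : IsPrimitiveRoot ζ 28) :
    Ideal.span {(2 + hζ.toInteger ^ 7 * (1 + 2 * (hζ.toInteger ^ 4 + hζ.toInteger ^ 8 + hζ.toInteger ^ 16)) : 𝓞 K)} *
      Ideal.span {(2 - hζ.toInteger ^ 7 * (1 + 2 * (hζ.toInteger ^ 4 + hζ.toInteger ^ 8 + hζ.toInteger ^ 16)) : 𝓞 K)} =
      Ideal.span {(3 : 𝓞 K)} := by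
  have hzK : algebraMap (𝓞 K) K hζ.toInteger = ζ := rfl
  rw [Ideal.span_singleton_mul_span_singleton, ← Ideal.span_singleton_neg (3 : 𝓞 K)]
  congr 2
  apply RingOfIntegers.ext
  push_cast; simp only [hzK, map_ofNat]
  linear_combination (-1 : K) * sq_sqrtSeven hζ

open scoped Classical in
/-- **ROW `(ℚ(ζ₂₈), ℚ(√−7))` — THE TYPE `(2 + √7)` EXISTS** (→ `(3, ℚ(√−7), 3)`, degree `27`, S-pencil): for every CM type `Φ`
balanced for `N_K = {3, 5, 13, 17, 19, 27}` and every `𝔣₀` with `𝔬𝔣₀ = (ϖ₃)`, a `Φ`-positive divisor of type `(K; Φ; 𝔣₀)` on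
`ℂ^Φ/Φ(ℤ[ζ₂₈])` (`|S_Φ ∩ X| ≡ |X ∖ N_K| + 3 = 3 + 3`).
research route conditional on HC_CM; not a corollary; Q11.4-sentence-2 already refuted in dim ≥ 3. [cite: Shimura1998, §14.3 Prop. 4–5, pp. 103–104] -/
theorem exists_type_twentyEight_three_sqrt_neg_seven [IsCMField K] [IsCyclotomicExtension {28} ℚ K]
    (hζ : IsPrimitiveRoot ζ 28) (Φ : CMType K)
    (hbal : 2 * (SΦ[Φ, ζ] ∩ ({3, 5, 13, 17, 19, 27} : Finset (ZMod 28))).card = (SΦ[Φ, ζ]).card)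
    {𝔣₀ : Ideal (𝓞 (maximalRealSubfield K))}
    (h𝔣₀ : 𝔣₀.map (algebraMap (𝓞 (maximalRealSubfield K)) (𝓞 K)) =
      Ideal.span {(2 + hζ.toInteger ^ 7 * (1 + 2 * (hζ.toInteger ^ 4 + hζ.toInteger ^ 8 + hζ.toInteger ^ 16)) : 𝓞 K)}) :
    ∃ ζ' : K, IsCMField.complexConj K ζ' = -ζ' ∧ (∀ φ : Φ.1, 0 < (φ.1 ζ').im) ∧
        CMTypeLattice.IsOfType (1 : (FractionalIdeal (𝓞 K)⁰ K)ˣ) ζ' 𝔣₀ := by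
  have hg : Nat.totient 28 = 2 * (5 + 1) := by decide
  obtain ⟨hA, hreal, h0⟩ := signSet_twentyEight_three hζ
  refine exists_type_of_even' hζ hg hreal h0 (coe_surd_twentyEight hζ) hA Φ h𝔣₀ (exists_units_sign_eq_twentyEight hζ Φ) ?_
  rw [twistSetA_twentyEight]
  have hS := isCMTypeSet_residueFilter hζ Φ
  have hX : IsCMTypeSet 28 ({3, 5, 9, 11, 15, 27} : Finset (ZMod 28)) := by decide
  have hNK : IsCMTypeSet 28 ({3, 5, 13, 17, 19, 27} : Finset (ZMod 28)) := by decide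
  have h1 := card_inter_mod_two_eq hS hX hNK
  have h2 := two_mul_card_eq_card_units hS
  have hU : (Finset.univ.filter fun t : ZMod 28 => t.val.Coprime 28).card = 12 := by decide
  have h3 : (({3, 5, 9, 11, 15, 27} : Finset (ZMod 28)) \ ({3, 5, 13, 17, 19, 27} : Finset (ZMod 28))).card = 3 := by decide
  rw [Nat.even_iff]
  omega

open scoped Classical in
/-- **ROW `(ℚ(ζ₂₈), ℚ(√−7))`, headline: `∃ 𝔣₀`, `𝔬𝔣₀·(2 − θ₇) = (3)`, and a `Φ`-positive divisor of type `(K; Φ; 𝔣₀)` on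
`ℂ^Φ/Φ(ℤ[ζ₂₈])`** for every `ℚ(√−7)`-balanced CM type `Φ` (degree `27`; S-pencil: on `(3, ℚ(√−7), 3)`).
research route conditional on HC_CM; not a corollary; Q11.4-sentence-2 already refuted in dim ≥ 3. [cite: Shimura1998, §14.3 Prop. 4–5, pp. 103–104] -/
theorem exists_surdType_twentyEight_three_sqrt_neg_seven [IsCMField K] [IsCyclotomicExtension {28} ℚ K]
    (hζ : IsPrimitiveRoot ζ 28) (Φ : CMType K)
    (hbal : 2 * (SΦ[Φ, ζ] ∩ ({3, 5, 13, 17, 19, 27} : Finset (ZMod 28))).card = (SΦ[Φ, ζ]).card) :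
    ∃ 𝔣₀ : Ideal (𝓞 (maximalRealSubfield K)),
      𝔣₀.map (algebraMap (𝓞 (maximalRealSubfield K)) (𝓞 K)) *
          Ideal.span {(2 - hζ.toInteger ^ 7 * (1 + 2 * (hζ.toInteger ^ 4 + hζ.toInteger ^ 8 + hζ.toInteger ^ 16)) : 𝓞 K)} =
        Ideal.span {(3 : 𝓞 K)} ∧
      ∃ ζ' : K, IsCMField.complexConj K ζ' = -ζ' ∧ (∀ φ : Φ.1, 0 < (φ.1 ζ').im) ∧
        CMTypeLattice.IsOfType (1 : (FractionalIdeal (𝓞 K)⁰ K)ˣ) ζ' 𝔣₀ := by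
  obtain ⟨-, hreal, -⟩ := signSet_twentyEight_three hζ
  obtain ⟨𝔣₀, h𝔣₀⟩ := exists_ideal_map_eq_span (coe_surd_twentyEight hζ) hreal
  exact ⟨𝔣₀, by rw [h𝔣₀]; exact span_mul_span_twentyEight_three hζ,
    exists_type_twentyEight_three_sqrt_neg_seven hζ Φ hbal h𝔣₀⟩

open scoped Classical in
/-- **Row `(ℚ(ζ₂₈), ℚ(i))` (YES for principal) does NOT carry the type `(2 + √7)`** (`N_K = {3, 11, 15, 19, 23, 27}`;
THEOREM L (i) at 28 + `|S_Φ ∩ X| ≡ 2 + 3`).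
research route conditional on HC_CM; not a corollary; Q11.4-sentence-2 already refuted in dim ≥ 3. [cite: Shimura1998, §14.3 Prop. 5, p. 104] -/
theorem not_exists_type_twentyEight_three_sqrt_neg_one [IsCMField K] [IsCyclotomicExtension {28} ℚ K]
    (hζ : IsPrimitiveRoot ζ 28) (Φ : CMType K)
    (hbal : 2 * (SΦ[Φ, ζ] ∩ ({3, 11, 15, 19, 23, 27} : Finset (ZMod 28))).card = (SΦ[Φ, ζ]).card)
    {𝔣₀ : Ideal (𝓞 (maximalRealSubfield K))}
    (h𝔣₀ : 𝔣₀.map (algebraMap (𝓞 (maximalRealSubfield K)) (𝓞 K)) =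
      Ideal.span {(2 + hζ.toInteger ^ 7 * (1 + 2 * (hζ.toInteger ^ 4 + hζ.toInteger ^ 8 + hζ.toInteger ^ 16)) : 𝓞 K)}) :
    ¬ ∃ ζ' : K, IsCMField.complexConj K ζ' = -ζ' ∧ (∀ φ : Φ.1, 0 < (φ.1 ζ').im) ∧
        CMTypeLattice.IsOfType (1 : (FractionalIdeal (𝓞 K)⁰ K)ˣ) ζ' 𝔣₀ := by
  have hg : Nat.totient 28 = 2 * (5 + 1) := by decide
  obtain ⟨hA, hreal, h0⟩ := signSet_twentyEight_three hζ
  refine not_exists_type_of_norm_pos_of_odd' hζ hg hreal h0 (coe_surd_twentyEight hζ) hA Φ h𝔣₀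
    (norm_realUnits_pos_twentyEight hζ) ?_
  rw [twistSetA_twentyEight]
  have hS := isCMTypeSet_residueFilter hζ Φ
  have hX : IsCMTypeSet 28 ({3, 5, 9, 11, 15, 27} : Finset (ZMod 28)) := by decide
  have hNK : IsCMTypeSet 28 ({3, 11, 15, 19, 23, 27} : Finset (ZMod 28)) := by decide
  have h1 := card_inter_mod_two_eq hS hX hNK
  have h2 := two_mul_card_eq_card_units hS
  have hU : (Finset.univ.filter fun t : ZMod 28 => t.val.Coprime 28).card = 12 := by decide
  have h3 : (({3, 5, 9, 11, 15, 27} : Finset (ZMod 28)) \ ({3, 11, 15, 19, 23, 27} : Finset (ZMod 28))).card = 2 := by decide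
  rw [Nat.odd_iff]
  omega

end Level28


end Summit.HodgeConjecture.Ring2WeilCoverage.SurdTypesLevel28

end
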